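import Summits.AtomisticToContinuum.Crystallization.Theorems.HullExactificationCascadeHullExactShellsLimits

/-!
# Crux `DisclinationRation.HullGlue` (stmt-AtomisticToContinuum-15802), line `birth` —
# stub 2 `stub_hullCompactness`: hull compactness with root and density

Soft compactness step of the second hull exactification.  Let `X n ⊆ ℝ³` (`n : ℕ`) be
`δ`-separated (`δ > 0`) hull elements of a fixed family `x` of finite configurations (two-way
`ε`-matched with translates of `x (φ j)` on every ball, eventually in `j`), each containing `0`
and each `R₁`-dense.  Then a subsequence `X (ψ k)` converges locally — `BallMatch ε R 0 (X (ψ k)) S₂`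
eventually in `k`, for every `R` and every `ε > 0` — to a `δ`-separated `S₂ ∋ 0` which is again a
hull element of `x` and is `(R₁ + 1)`-dense.

Proof (`stub_hullCompactness`): sequential compactness of `δ`-separated sets in the local matching
topology (`exists_subseq_forall_eventually_ballMatch`, `LocalMatchingCompactness.lean`) gives `ψ`
and the `δ`-separated limit `S₂`; the root survives (`HullExactShells.zero_mem_of_ballMatch`);
local limits of local limits of `x` are local limits of `x`
(`HullExactShells.isLimit_of_eventually_ballMatch`, diagonal argument); and one matching step at
tolerance `1` on the ball of radius `‖p‖ + R₁` moves the `R₁`-close point of `X (ψ k)` to an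
`(R₁ + 1)`-close point of `S₂`.  All `[folklore]` (Radin 1991 §2; Baake–Grimm 2013, Remark 5.6,
local rubber topology).
-/

noncomputable section

namespace Summit.AtomisticToContinuum.Crystallization.Theorems.DisclinationRationHullGlue

open Filter Topology Metric Set
open Literature.MathematicalPhysics.StatisticalMechanics
open Summit.AtomisticToContinuum.Crystallization.Theorems.HullExactShells

/-- **Stub 2 of line `birth` (crux `HullGlue`, stmt-AtomisticToContinuum-15802): hull compactness
with root and density.**  A sequence `X n ⊆ ℝ³` of `δ`-separated (`δ > 0`) hull elements of the
family `x`, each containing `0` and each `R₁`-dense, has a subsequence `X (ψ k)` converging locally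
(`BallMatch ε R 0 (X (ψ k)) S₂` eventually in `k`, every `R`, every `ε > 0`) to a `δ`-separated
`S₂ ∋ 0` which is again a hull element of `x` and is `(R₁ + 1)`-dense. [folklore] -/
theorem stub_hullCompactness : ∀ (x : (N : ℕ) → (Fin N → EuclideanSpace ℝ (Fin 3))) (X : ℕ → Set (EuclideanSpace ℝ (Fin 3))) (δ R₁ : ℝ), 0 < δ → (∀ n : ℕ, ∀ y ∈ X n, ∀ z ∈ X n, y ≠ z → δ ≤ dist y z) → (∀ n : ℕ, (0 : EuclideanSpace ℝ (Fin 3)) ∈ X n) → (∀ n : ℕ, ∃ φ : ℕ → ℕ, StrictMono φ ∧ ∃ τ : ℕ → EuclideanSpace ℝ (Fin 3), ∀ R ε : ℝ, 0 < ε → ∀ᶠ j : ℕ in Filter.atTop, (∀ s ∈ X n, ‖s‖ ≤ R → ∃ i : Fin (φ j), dist (x (φ j) i + τ j) s ≤ ε) ∧ (∀ i : Fin (φ j), ‖x (φ j) i + τ j‖ ≤ R → ∃ s ∈ X n, dist (x (φ j) i + τ j) s ≤ ε)) → (∀ n : ℕ, ∀ p : EuclideanSpace ℝ (Fin 3), ∃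 y ∈ X n, dist y p ≤ R₁) → ∃ ψ : ℕ → ℕ, StrictMono ψ ∧ ∃ S₂ : Set (EuclideanSpace ℝ (Fin 3)), (∀ y ∈ S₂, ∀ z ∈ S₂, y ≠ z → δ ≤ dist y z) ∧ (0 : EuclideanSpace ℝ (Fin 3)) ∈ S₂ ∧ (∃ φ : ℕ → ℕ, StrictMono φ ∧ ∃ τ : ℕ → EuclideanSpace ℝ (Fin 3), ∀ R ε : ℝ, 0 < ε → ∀ᶠ j : ℕ in Filter.atTop, (∀ s ∈ S₂, ‖s‖ ≤ R → ∃ i : Fin (φ j), dist (x (φ j) i + τ j) s ≤ ε) ∧ (∀ i : Fin (φ j), ‖x (φ j) i + τ j‖ ≤ R → ∃ s ∈ S₂, dist (x (φ j) i + τ j) s ≤ ε)) ∧ (∀ p : EuclideanSpace ℝ (Fin 3), ∃ y ∈ S₂, dist y p ≤ R₁ + 1) ∧ (∀ R ε : ℝ, 0 < ε → ∀ᶠ k : ℕ in Filter.atTop, Literature.MathematicalPhysics.StatisticalMechanics.BallMatch ε R 0 (X (ψ k)) S₂) := by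
  intro x X δ R₁ hδ hsep h0 hHL hdense
  -- Step 1: a locally convergent subsequence with `δ`-separated limit `S₂`
  obtain ⟨ψ, S₂, hψ, hsep₂, hlim⟩ := exists_subseq_forall_eventually_ballMatch hδ X hsep
  refine ⟨ψ, hψ, S₂, hsep₂, ?_, ?_, ?_, hlim⟩
  · -- Step 2: the root survives, `0 ∈ S₂`
    exact HullExactShells.zero_mem_of_ballMatch (T := fun k => X (ψ k)) hδ hsep₂
      (Eventually.of_forall fun k => h0 (ψ k)) hlim
  · -- Step 3: `S₂` is a local limit of translates of `x` (limits of local limits, diagonal)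
    exact HullExactShells.isLimit_of_eventually_ballMatch (Xs := fun k => X (ψ k))
      (fun k => hHL (ψ k)) hlim
  · -- Step 4: `S₂` is `(R₁ + 1)`-dense, by one matching step at tolerance `1`
    intro p
    obtain ⟨k, hk⟩ := (hlim (‖p‖ + R₁) 1 one_pos).exists
    obtain ⟨y, hy, hyp⟩ := hdense (ψ k) p
    have hy0 : dist y 0 ≤ ‖p‖ + R₁ := by
      rw [dist_zero_right]
      linarith [HullExactShells.norm_le_norm_add_dist y p]
    obtain ⟨s, hs, hys⟩ := hk.2 y hy hy0
    refine ⟨s, hs, ?_⟩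
    rw [dist_comm] at hys
    calc dist s p ≤ dist s y + dist y p := dist_triangle _ _ _
      _ ≤ 1 + R₁ := add_le_add hys hyp
      _ = R₁ + 1 := add_comm _ _

end Summit.AtomisticToContinuum.Crystallization.Theorems.DisclinationRationHullGlue

end
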